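import Literature.NumberTheory.Sieve.LargeGapsCoveringTransfer
import Literature.NumberTheory.Sieve.ErdosRankinCovering
import Literature.NumberTheory.Sieve.RankinSmoothNumbers
import Literature.NumberTheory.Sieve.RankinComposedTail
import Literature.NumberTheory.LFunctions.MertensElementary
import Literature.NumberTheory.LFunctions.RHWave0PNTProofs
import HarnessLib

/-!
# Ford–Green–Konyagin–Maynard–Tao 2018, §3: Theorem 2 («Sieving primes») and the PROVED
# deduction Theorem 2 ⇒ (1.2) ⇒ Theorem 1

Topic `Literature/NumberTheory/Sieve`. Source: K. Ford, B. Green, S. Konyagin, J. Maynard, T. Tao,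
*Long gaps between primes*, J. Amer. Math. Soc. 31 (2018) 65–105 = arXiv:1412.5029, §3 «Sieving a
set of primes» [FordGreenKonyaginMaynardTao2018].

The ladder file `LargeGapsBetweenPrimes.lean` types Theorem 1 (`G(X) ≫ log X log₂ X log₄ X/log₃ X`,
`FordGreenKonyaginMaynardTao2018_theorem1`) and the covering bound (1.2)
(`Y(x) ≫ x log x log₃ x/log₂ x`, `FordGreenKonyaginMaynardTao2018_coveringBound`), and
`LargeGapsCoveringTransfer.lean` PROVES (1.2) ⇒ Theorem 1. This file goes one section further
into the paper:

* it TYPES **Theorem 2** (p. 8): with `y := c x log x log₃ x/log₂ x`, `z := x^{log₃ x/(4 log₂ x)}`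
  and the three disjoint sets of primes `𝒮 = {s : log²⁰ x < s ≤ z}`, `𝒫 = {p : x/2 < p ≤ x}`,
  `𝒬 = {q : x < q ≤ y}`, «there are vectors `a⃗ = (a_s mod s)_{s ∈ 𝒮}` and `b⃗ = (b_p mod p)_{p ∈ 𝒫}`
  such that `#(𝒬 ∩ S(a⃗) ∩ S(b⃗)) ≪ x/log x`» — the named fact
  `FordGreenKonyaginMaynardTao2018_theorem2` (NOT proved here: it is the output of §§4–8 of the
  paper, the hypergraph covering theorem and the Maynard sieve weights);
* it PROVES the deduction of §3, **Theorem 2 ⇒ (1.2)** (`fgkmt2018_coveringBound_of_theorem2`), hence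
  **Theorem 2 ⇒ Theorem 1** (`fgkmt2018_theorem1_of_theorem2`), exactly along the printed lines:
  extend `a⃗, b⃗` by `a_p := 0` for the other primes `p ≤ x`; an element of `(x, y]` avoiding every
  class is either `z`-smooth or a prime of `𝒬 ∩ S(a⃗) ∩ S(b⃗)` (`mem_smooth_or_sifted`, using
  `y = o(x log x)` in the form `2y < x log²⁰ x`); the `z`-smooth numbers in `[y]` are `O(x/log x)`
  (`card_smooth_le_of_params`); the `O(x/log x)` survivors are matched with distinct primes of `(x, Cx]`
  (prime number theorem), giving classes for all `p ≤ Cx` covering `(x, y]`, i.e. `Y(Cx) ≥ y − x`.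

DISCLOSURES. (1) Smooth numbers: the paper quotes de Bruijn's theorem
`#ℛ ≪ y e^{−u log u + O(u log log u)} = y/log^{4+o(1)} x` and remarks (Remark 1) that Rankin's simpler
bound suffices after changing the `4` in the definition of `z`; we keep the printed `z` and use the
tree's Rankin bound `Ψ(N, k) ≤ N^{1−η} ∏_{p<k}(1 − p^{η−1})⁻¹` (`card_smoothNumbersUpTo_le_rankin`)
with `η = (7/2) log₂ x/log x` and the Mertens-quality Euler-product estimates of
`RankinComposedTail.lean` (`prod_inv_le_exp`, `sum_excess_le`), which give `#ℛ ≤ x/log x` — all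
that the argument needs (`o(x/log x)` is not needed, `O` suffices since the implied constant of
Theorem 2 is absorbed into `C`). (2) `x` is a natural number here (the paper lets `x` be real; the
statement over `ℕ` is the one the covering bound `Y(x)`, `x ∈ ℕ`, consumes, and is implied by the
real one). (3) «`≪ x/log x`» is rendered with an explicit existential constant `K` (depending on the
fixed `c`), and «`x` sufficiently large» as `∀ᶠ x in atTop`.

## Main statements

* `FGKMT2018.ySieve`, `FGKMT2018.zSieve`, `FGKMT2018.primesS`, `FGKMT2018.primesHalf`,
  `FGKMT2018.primesQ`, `FGKMT2018.siftedPrimes` : the data `y, z, 𝒮, 𝒫, 𝒬, 𝒬 ∩ S(a⃗) ∩ S(b⃗)` of §3;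
* `FordGreenKonyaginMaynardTao2018_theorem2` : Theorem 2 (named fact);
* `FGKMT2018.mem_smooth_or_sifted` : the survivors of the extended sieve are `z`-smooth or sifted primes;
* `FGKMT2018.card_smooth_le_of_params` : Rankin-type bound `#{n ≤ y : n z-smooth} ≤ x/log x`;
* `FGKMT2018.card_uncoveredShifts_le` : `#𝒯 ≤ #ℛ + #(𝒬 ∩ S(a⃗) ∩ S(b⃗))`;
* `FGKMT2018.residueClassesCover_of_card_le` : matching survivors with primes in `(x, Cx]`;
* `fgkmt2018_coveringBound_of_theorem2` : **Theorem 2 ⇒ (1.2)** (PROVED);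
* `fgkmt2018_theorem1_of_theorem2` : **Theorem 2 ⇒ Theorem 1** (PROVED).

## References

* K. Ford, B. Green, S. Konyagin, J. Maynard, T. Tao, *Long gaps between primes*, J. Amer. Math. Soc.
  31 (2018) 65–105, §3, Theorem 2, Remark 1. [FordGreenKonyaginMaynardTao2018]
* R. A. Rankin, *The difference between consecutive prime numbers*, J. London Math. Soc. 13 (1938)
  242–247 (Rankin's method). [Rankin1938]
* H. L. Montgomery, R. C. Vaughan, *Multiplicative Number Theory I*, CUP 2007, §7.1. [MontgomeryVaughan2007]
-/

noncomputable section

open Filter Finset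

namespace Literature.NumberTheory.Sieve

namespace FGKMT2018

/-! ### The data of §3 -/

/-- `y := c x log x log₃ x / log₂ x` ((3.1); `log_k = Real.log^[k]`).
[cite: FordGreenKonyaginMaynardTao2018, (3.1)] -/
def ySieve (c : ℝ) (x : ℕ) : ℝ :=
  c * ((x : ℝ) * Real.log x * Real.log^[3] x / Real.log^[2] x)

/-- `z := x^{log₃ x/(4 log₂ x)}` ((3.2)). [cite: FordGreenKonyaginMaynardTao2018, (3.2)] -/
def zSieve (x : ℕ) : ℝ :=
  (x : ℝ) ^ (Real.log^[3] x / (4 * Real.log^[2] x))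

/-- `𝒮 := {s prime : log²⁰ x < s ≤ z}` ((3.3)). [cite: FordGreenKonyaginMaynardTao2018, (3.3)] -/
def primesS (x : ℕ) : Finset ℕ :=
  (Finset.Icc 1 ⌊zSieve x⌋₊).filter (fun s => s.Prime ∧ (Real.log x) ^ 20 < (s : ℝ))

/-- `𝒫 := {p prime : x/2 < p ≤ x}` ((3.4)). [cite: FordGreenKonyaginMaynardTao2018, (3.4)] -/
def primesHalf (x : ℕ) : Finset ℕ :=
  (Finset.Icc 1 x).filter (fun p => p.Prime ∧ x < 2 * p)

/-- `𝒬 := {q prime : x < q ≤ y}` ((3.5)). [cite: FordGreenKonyaginMaynardTao2018, (3.5)] -/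
def primesQ (c : ℝ) (x : ℕ) : Finset ℕ :=
  (Finset.Icc (x + 1) ⌊ySieve c x⌋₊).filter Nat.Prime

/-- The sifted set `𝒬 ∩ S(a⃗) ∩ S(b⃗)` for `a⃗ = (a_s mod s)_{s ∈ 𝒮}`, `b⃗ = (b_p mod p)_{p ∈ 𝒫}`, where
`S(a⃗) := {n : n ≢ a_s (mod s) for all s ∈ 𝒮}` and likewise `S(b⃗)`.
[cite: FordGreenKonyaginMaynardTao2018, §3 (definition of `S(a⃗)`, `S(b⃗)`)] -/
def siftedPrimes (c : ℝ) (x : ℕ) (a b : ℕ → ℕ) : Finset ℕ :=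
  (primesQ c x).filter
    (fun q => (∀ s ∈ primesS x, ¬ q ≡ a s [MOD s]) ∧ (∀ p ∈ primesHalf x, ¬ q ≡ b p [MOD p]))

end FGKMT2018

/-- **Ford–Green–Konyagin–Maynard–Tao 2018, Theorem 2 (Sieving primes).** «Let `x` be sufficiently
large and suppose that `y` obeys (3.1) [`y = c x log x log₃ x/log₂ x`, where `c` is a certain (small)
fixed positive constant]. Then there are vectors `a⃗ = (a_s mod s)_{s ∈ 𝒮}` and `b⃗ = (b_p mod p)_{p ∈ 𝒫}`
such that `#(𝒬 ∩ S(a⃗) ∩ S(b⃗)) ≪ x/log x`.» Rendered over `x ∈ ℕ` with an explicit implied constant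
`K`. Named fact, not proved here (it is proved in §§4–8 of the paper from the hypergraph covering
theorem (Theorem 3) and the sieve-weight construction (Theorems 4–6)).
[cite: FordGreenKonyaginMaynardTao2018, Theorem 2] -/
def FordGreenKonyaginMaynardTao2018_theorem2 : Prop :=
  ∃ c : ℝ, 0 < c ∧ ∃ K : ℝ, ∀ᶠ x : ℕ in atTop, ∃ a b : ℕ → ℕ,
    ((FGKMT2018.siftedPrimes c x a b).card : ℝ) ≤ K * ((x : ℝ) / Real.log x)

namespace FGKMT2018

/-! ### Step 1: survivors of the extended sieve are `z`-smooth or sifted primes of `𝒬` -/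

/-- The extension of `a⃗, b⃗` to all primes `p ≤ x`: «setting `a_p := b_p` for `p ∈ 𝒫` and `a_p := 0`
for `p ∉ 𝒮 ∪ 𝒫`». [cite: FordGreenKonyaginMaynardTao2018, §3 (proof of (1.2))] -/
def sieveClass (x : ℕ) (a b : ℕ → ℕ) (p : ℕ) : ℕ :=
  if p ∈ primesS x then a p else if p ∈ primesHalf x then b p else 0

/-- **The survivors are smooth or prime.** If `2y < x log²⁰ x`, `2 log²⁰ x ≤ x` and `z ≤ x/2`, then
every `n ∈ (x, y]` with `n ≢ a_p (mod p)` for all primes `p ≤ x` (extended classes) is either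
`z`-smooth (all prime factors `≤ ⌊z⌋`) or a prime of `𝒬 ∩ S(a⃗) ∩ S(b⃗)`: «each element must either
be a `z`-smooth number, or must consist of a prime greater than `x/2`, possibly multiplied by some
additional primes that are all at least `log²⁰ x`. However, `y = o(x log x)`. Thus an element of `𝒯`
is either a `z`-smooth number or a prime in `𝒬`.» [cite: FordGreenKonyaginMaynardTao2018, §3 (proof of (1.2))] -/
theorem mem_smooth_or_sifted {c : ℝ} {x : ℕ} {a b : ℕ → ℕ}
    (hy : 2 * ySieve c x < (x : ℝ) * (Real.log x) ^ 20)
    (hlog : 2 * (Real.log x) ^ 20 ≤ (x : ℝ)) (hz : 2 * zSieve x ≤ (x : ℝ))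
    {n : ℕ} (hxn : x < n) (hny : n ≤ ⌊ySieve c x⌋₊)
    (hn : ∀ p : ℕ, p.Prime → p ≤ x → ¬ n ≡ sieveClass x a b p [MOD p]) :
    n ∈ Nat.smoothNumbersUpTo ⌊ySieve c x⌋₊ (⌊zSieve x⌋₊ + 1) ∨ n ∈ siftedPrimes c x a b := by
  classical
  have hn0 : n ≠ 0 := by omega
  have hx0 : (0 : ℝ) ≤ x := Nat.cast_nonneg x
  have hyn : (n : ℝ) ≤ ySieve c x := by
    have h1 : ((⌊ySieve c x⌋₊ : ℕ) : ℝ) ≤ ySieve c x := by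
      refine Nat.floor_le ?_
      by_contra hneg
      have : ⌊ySieve c x⌋₊ = 0 := Nat.floor_of_nonpos (le_of_lt (lt_of_not_ge hneg))
      omega
    exact le_trans (by exact_mod_cast hny) h1
  have hxpos : (0 : ℝ) < x := by
    have hn1 : (1 : ℝ) ≤ n := by exact_mod_cast (show 1 ≤ n by omega)
    rcases Nat.eq_zero_or_pos x with hx00 | hx00
    · exfalso
      have : (x : ℝ) * Real.log x ^ 20 = 0 := by rw [hx00]; simp
      linarith
    · exact_mod_cast hx00
  -- no prime `p ≤ x` outside `𝒮 ∪ 𝒫` divides `n`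
  have hndvd : ∀ p : ℕ, p.Prime → p ≤ x → p ∉ primesS x → p ∉ primesHalf x → ¬ p ∣ n := by
    intro p hp hpx hS hP hdvd
    refine hn p hp hpx ?_
    rw [sieveClass, if_neg hS, if_neg hP]
    exact (Nat.modEq_zero_iff_dvd.2 hdvd)
  -- a divisor `m` of `n` with `2 ≤ m` and `(m : ℝ) < log²⁰ x` is impossible
  have hsmall : ∀ m : ℕ, 2 ≤ m → m ∣ n → ((m : ℝ) < (Real.log x) ^ 20) → False := by
    intro m hm2 hmn hmlog
    obtain ⟨p', hp', hp'm⟩ := Nat.exists_prime_and_dvd (show m ≠ 1 by omega)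
    have hp'le : p' ≤ m := Nat.le_of_dvd (by omega) hp'm
    have hp'r : (p' : ℝ) < (Real.log x) ^ 20 := lt_of_le_of_lt (by exact_mod_cast hp'le) hmlog
    have hp'x2 : 2 * p' ≤ x := by
      have : (2 : ℝ) * p' ≤ x := by linarith
      exact_mod_cast this
    have hp'x : p' ≤ x := by omega
    have hS : p' ∉ primesS x := by
      intro h
      rw [primesS, Finset.mem_filter] at h
      linarith [h.2.2]
    have hP : p' ∉ primesHalf x := by
      intro h
      rw [primesHalf, Finset.mem_filter] at h
      omega
    exact hndvd p' hp' hp'x hS hP (dvd_trans hp'm hmn)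
  by_cases hsm : n ∈ Nat.smoothNumbers (⌊zSieve x⌋₊ + 1)
  · exact Or.inl (Nat.mem_smoothNumbersUpTo.2 ⟨hny, hsm⟩)
  right
  rw [Nat.mem_smoothNumbers'] at hsm
  push Not at hsm
  obtain ⟨P, hP, hPn, hPz⟩ := hsm
  -- `P > z`, so `P ∉ 𝒮`
  have hPS : P ∉ primesS x := by
    intro h
    rw [primesS, Finset.mem_filter, Finset.mem_Icc] at h
    omega
  obtain ⟨m, hm⟩ := hPn
  -- the cofactor `m = n / P`
  have hm1 : 1 ≤ m := by
    rcases Nat.eq_zero_or_pos m with rfl | h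
    · simp at hm; exact absurd hm hn0
    · exact h
  have hmdvd : m ∣ n := ⟨P, by rw [hm, mul_comm]⟩
  by_cases hPx : P ≤ x
  · -- then `P ∈ 𝒫` (else `P ∣ n` with class `0`), and the cofactor is `≥ 2` and `< log²⁰ x`
    have hPP : P ∈ primesHalf x := by
      by_contra h
      exact hndvd P hP hPx hPS h ⟨m, hm⟩
    have hx2P : x < 2 * P := by
      rw [primesHalf, Finset.mem_filter] at hPP; exact hPP.2.2
    have hm2 : 2 ≤ m := by
      by_contra h
      have : m = 1 := by omega
      subst this
      simp at hm
      omega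
    refine (hsmall m hm2 hmdvd ?_).elim
    -- `m x < 2 m P = 2 n ≤ 2 y < x log²⁰ x`
    have h1 : (m : ℝ) * x < 2 * n := by
      have : m * x < 2 * n := by
        calc m * x < m * (2 * P) := Nat.mul_lt_mul_of_pos_left hx2P (by omega)
          _ = 2 * n := by rw [hm]; ring
      exact_mod_cast this
    nlinarith
  · -- `P > x`: the cofactor is `< y/x < log²⁰ x`, hence `m = 1` and `n = P` is a sifted prime of `𝒬`
    push Not at hPx
    have hm1' : m = 1 := by
      by_contra h
      have hm2 : 2 ≤ m := by omega
      refine (hsmall m hm2 hmdvd ?_).elim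
      have h1 : (m : ℝ) * x < n := by
        have : m * x < n := by
          calc m * x < m * P := Nat.mul_lt_mul_of_pos_left hPx (by omega)
            _ = n := by rw [hm, mul_comm]
        exact_mod_cast this
      nlinarith
    subst hm1'
    rw [mul_one] at hm
    subst hm
    rw [siftedPrimes, Finset.mem_filter, primesQ, Finset.mem_filter, Finset.mem_Icc]
    refine ⟨⟨⟨by omega, hny⟩, hP⟩, fun s hs => ?_, fun p hp => ?_⟩
    · have hs' := hs
      rw [primesS, Finset.mem_filter, Finset.mem_Icc] at hs'
      have hsz : (s : ℝ) ≤ zSieve x := by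
        have := Nat.floor_le (show 0 ≤ zSieve x from Real.rpow_nonneg hx0 _)
        exact le_trans (by exact_mod_cast hs'.1.2) this
      have hsx : s ≤ x := by
        have : (s : ℝ) ≤ x := by linarith
        exact_mod_cast this
      have h := hn s hs'.2.1 hsx
      rwa [sieveClass, if_pos hs] at h
    · have hp' := hp
      rw [primesHalf, Finset.mem_filter, Finset.mem_Icc] at hp'
      have hpS : p ∉ primesS x := by
        intro h
        rw [primesS, Finset.mem_filter, Finset.mem_Icc] at h
        have hpz : (p : ℝ) ≤ zSieve x := by
          have := Nat.floor_le (show 0 ≤ zSieve x from Real.rpow_nonneg hx0 _)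
          exact le_trans (by exact_mod_cast h.1.2) this
        have : (x : ℝ) < 2 * p := by exact_mod_cast hp'.2.2
        linarith
      have h := hn p hp'.2.1 hp'.1.2
      rwa [sieveClass, if_neg hpS, if_pos hp] at h


/-! ### Step 2: the uncovered part of `(x, y]` is at most `#ℛ + #(𝒬 ∩ S(a⃗) ∩ S(b⃗))` -/

/-- The set of `t ∈ [1, L]` whose translate `x + t` avoids every extended class `a_p (mod p)`,
`p ≤ x` prime — the translate by `−x` of the paper's
`𝒯 := {n ∈ [y] ∖ [x] : n ≢ a_p (mod p) for all p ≤ x}` (with `L = ⌊y⌋ − x`).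
[cite: FordGreenKonyaginMaynardTao2018, §3 (definition of `𝒯`)] -/
def uncoveredShifts (x L : ℕ) (a b : ℕ → ℕ) : Finset ℕ :=
  (Finset.Icc 1 L).filter (fun t => ∀ p ∈ Nat.primesLE x, ¬ x + t ≡ sieveClass x a b p [MOD p])

/-- «Thus, `𝒯` only differs from `𝒬 ∩ S(a⃗) ∩ S(b⃗)` by a set `ℛ` consisting of `z`-smooth numbers in
`[y]`»: `#𝒯 ≤ #ℛ + #(𝒬 ∩ S(a⃗) ∩ S(b⃗))`. [cite: FordGreenKonyaginMaynardTao2018, §3 (proof of (1.2))] -/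
theorem card_uncoveredShifts_le {c : ℝ} {x : ℕ} {a b : ℕ → ℕ}
    (hy : 2 * ySieve c x < (x : ℝ) * (Real.log x) ^ 20)
    (hlog : 2 * (Real.log x) ^ 20 ≤ (x : ℝ)) (hz : 2 * zSieve x ≤ (x : ℝ)) :
    (uncoveredShifts x (⌊ySieve c x⌋₊ - x) a b).card ≤
      (Nat.smoothNumbersUpTo ⌊ySieve c x⌋₊ (⌊zSieve x⌋₊ + 1)).card + (siftedPrimes c x a b).card := by
  classical
  refine le_trans ?_ (Finset.card_union_le _ _)
  refine Finset.card_le_card_of_injOn (fun t => x + t) (fun t ht => ?_) (fun t₁ _ t₂ _ h => by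
    simpa using h)
  have ht' : t ∈ uncoveredShifts x (⌊ySieve c x⌋₊ - x) a b := by simpa using ht
  rw [uncoveredShifts, Finset.mem_filter, Finset.mem_Icc] at ht'
  obtain ⟨⟨ht1, htL⟩, hcl⟩ := ht'
  dsimp only
  rw [Finset.mem_coe, Finset.mem_union]
  refine mem_smooth_or_sifted hy hlog hz (by omega) (by omega) fun p hp hpx => ?_
  exact hcl p (Nat.mem_primesLE.2 ⟨hpx, hp⟩)

/-! ### Step 3: matching the survivors with primes of `(x, Cx]` -/

/-- **Matching the survivors.** «Let `C` be a sufficiently large constant such that `#𝒯` is less than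
the number of primes in `(x, Cx]`. By matching each of these surviving elements to a distinct prime in
`(x, Cx]` and choosing congruence classes appropriately, we thus find congruence classes `a_p mod p` for
`p ≤ Cx` which cover all of the integers in `(x, y]`», i.e. (after translating by `−x`) `Y(Cx) ≥ ⌊y⌋ − x`.
[cite: FordGreenKonyaginMaynardTao2018, §3 (proof of (1.2))] -/
theorem residueClassesCover_of_card_le {x L C : ℕ} {a b : ℕ → ℕ} (hC : 1 ≤ C)
    (h : (uncoveredShifts x L a b).card ≤ ((Finset.Ioc x (C * x)).filter Nat.Prime).card) :
    ResidueClassesCover (C * x) L := by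
  classical
  obtain ⟨c', hc'⟩ := exists_classes_of_card_le (uncoveredShifts x L a b) ((Finset.Ioc x (C * x)).filter
    Nat.Prime) h
  refine ⟨fun p => if p ≤ x then sieveClass x a b p + p * x - x else c' p, fun t ht1 htL => ?_⟩
  by_cases hbad : t ∈ uncoveredShifts x L a b
  · obtain ⟨q, hq, hmod⟩ := hc' t hbad
    rw [Finset.mem_filter, Finset.mem_Ioc] at hq
    refine ⟨q, hq.2, hq.1.2, ?_⟩
    dsimp only
    rwa [if_neg (not_le.2 hq.1.1)]
  · have hex : ∃ p ∈ Nat.primesLE x, x + t ≡ sieveClass x a b p [MOD p] := by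
      by_contra hne
      push Not at hne
      exact hbad (Finset.mem_filter.2 ⟨Finset.mem_Icc.2 ⟨ht1, htL⟩, hne⟩)
    obtain ⟨p, hp, hmod⟩ := hex
    rw [Nat.mem_primesLE] at hp
    have hxle : x ≤ C * x := Nat.le_mul_of_pos_left x hC
    refine ⟨p, hp.2, hp.1.trans hxle, ?_⟩
    dsimp only
    rw [if_pos hp.1]
    have hpx : x ≤ p * x := Nat.le_mul_of_pos_left x hp.2.pos
    -- `x + t ≡ e ≡ e + p x (mod p)`, so `t ≡ e + p x − x (mod p)`
    have h1 : x + t ≡ sieveClass x a b p + p * x [MOD p] :=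
      hmod.trans ((Nat.modEq_iff_dvd' (Nat.le_add_right _ _)).2 (by simp))
    refine Nat.ModEq.add_right_cancel' x ?_
    rw [Nat.sub_add_cancel (le_trans hpx (Nat.le_add_left _ _)), add_comm t x]
    exact h1

/-! ### Step 4: the `z`-smooth numbers in `[y]` are `O(x/log x)` (Rankin's method) -/

/-- **The smooth part** («By standard counts for smooth numbers … `#ℛ ≪ y e^{−u log u + O(u log log(u+2))}
= y/log^{4+o(1)} x = o(x/log x)`»; cf. Remark 1: Rankin's bound suffices), in deterministic form: with
`ℓ = log x`, `ℓ₂ = log ℓ`, `ℓ₃ = log ℓ₂`, Rankin's exponent `η = (7/2) ℓ₂/ℓ ≤ 2/5`, `2 ≤ Z`,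
`log Z ≤ ℓ ℓ₃/(4 ℓ₂)` (i.e. `Z ≤ z`), `x ≤ Y ≤ c x ℓ ℓ₃/ℓ₂` and the growth conditions
`8 log 96 ≤ ℓ₃`, `log c + 7 + C₀ ≤ ℓ₂/4`: `Ψ(Y, Z) = #{n ≤ Y : p ∣ n ⇒ p ≤ Z} ≤ x/log x`. Proof:
`Ψ ≤ Y^{1−η} ∏_{p ≤ Z}(1 − p^{η−1})⁻¹ ≤ Y ℓ^{−7/2} exp(∑_{p ≤ Z} p^{η−1} + C₀)`, and
`∑_{p ≤ Z} p^{η−1} ≤ log log Z + 4 + 3 + 24 Z^η ≤ (5/4) ℓ₂ + 7` as `Z^η ≤ e^{7ℓ₃/8} ≤ ℓ₂/96`.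
[cite: FordGreenKonyaginMaynardTao2018, §3 (proof of (1.2)) and Remark 1]
[cite: MontgomeryVaughan2007, §7.1 (Rankin's method)] -/
theorem card_smooth_le_of_params {x Y Z : ℕ} {c ℓ ℓ₂ ℓ₃ η : ℝ} (hc : 0 < c) (hx : 16 ≤ x)
    (hℓ : ℓ = Real.log x) (hℓ₂ : ℓ₂ = Real.log ℓ) (hℓ₃ : ℓ₃ = Real.log ℓ₂)
    (hη : η = 7 / 2 * ℓ₂ / ℓ) (hηle : η ≤ 2 / 5)
    (hZ2 : 2 ≤ Z) (hZ : Real.log Z ≤ ℓ * ℓ₃ / (4 * ℓ₂))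
    (hxY : x ≤ Y) (hY : (Y : ℝ) ≤ c * ((x : ℝ) * ℓ * ℓ₃ / ℓ₂))
    (hG1 : 8 * Real.log 96 ≤ ℓ₃) (hG2 : Real.log c + 7 + RankinComposed.C₀ ≤ ℓ₂ / 4) :
    ((Nat.smoothNumbersUpTo Y (Z + 1)).card : ℝ) ≤ (x : ℝ) / ℓ := by
  classical
  -- positivity chain
  have hx0 : (0 : ℝ) < x := by exact_mod_cast (show 0 < x by omega)
  have hx16 : (16 : ℝ) ≤ x := by exact_mod_cast hx
  have hℓ1 : 1 < ℓ := by
    rw [hℓ, ← Real.exp_lt_exp, Real.exp_log hx0]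
    have := Real.exp_one_lt_d9; linarith
  have hℓ0 : 0 < ℓ := by linarith
  have hℓ₂0 : 0 < ℓ₂ := by rw [hℓ₂]; exact Real.log_pos hℓ1
  have hlog96 : 0 < Real.log 96 := Real.log_pos (by norm_num)
  have hℓ₃36 : 1 ≤ ℓ₃ := by
    have : Real.log 2 ≤ Real.log 96 := Real.log_le_log (by norm_num) (by norm_num)
    linarith [Real.log_two_gt_d9]
  have hℓ₃0 : 0 < ℓ₃ := by linarith
  have hexpℓ₂ : Real.exp ℓ₂ = ℓ := by rw [hℓ₂, Real.exp_log hℓ0]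
  have hexpℓ₃ : Real.exp ℓ₃ = ℓ₂ := by rw [hℓ₃, Real.exp_log hℓ₂0]
  have hℓ₃le : ℓ₃ ≤ ℓ₂ := by
    rw [hℓ₃]; linarith [Real.log_le_sub_one_of_pos hℓ₂0]
  have hη0 : 0 < η := by rw [hη]; positivity
  have hη12 : η ≤ 1 / 2 := by linarith
  set σ : ℝ := 1 - η with hσdef
  have hσ0 : 0 < σ := by linarith
  have hσ35 : 3 / 5 ≤ σ := by linarith
  have hY0 : (0 : ℝ) < Y := lt_of_lt_of_le hx0 (by exact_mod_cast hxY)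
  have hZ0 : (0 : ℝ) < Z := by exact_mod_cast (show 0 < Z by omega)
  -- Rankin: `Ψ(Y, Z) ≤ Y^σ ∏_{p < Z+1} (1 − p^{−σ})⁻¹`
  have h1 := card_smoothNumbersUpTo_le_rankin Y (Z + 1) hσ0
  have hprimes : ∀ p ∈ (Z + 1).primesBelow, p.Prime := fun p hp => Nat.prime_of_mem_primesBelow hp
  have h2 := RankinComposed.prod_inv_le_exp hprimes hσ35
  -- the prime sum `∑_{p ≤ Z} p^{−σ} = ∑ (p^η − 1)/p + ∑ 1/p`
  have hPB : (Z + 1).primesBelow = Nat.primesLE Z := rfl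
  have hsum : ∑ p ∈ (Z + 1).primesBelow, (p : ℝ) ^ (-σ) =
      ∑ p ∈ Nat.primesLE Z, ((p : ℝ) ^ η - 1) / p + ∑ p ∈ Nat.primesLE Z, (1 : ℝ) / p := by
    rw [hPB, ← Finset.sum_add_distrib]
    refine Finset.sum_congr rfl fun p hp => ?_
    have hp0 : (p : ℝ) ≠ 0 := by
      have := (Nat.mem_primesLE.1 hp).2.pos
      exact_mod_cast this.ne'
    rw [hσdef, show -(1 - η) = η - 1 by ring, Real.rpow_sub_one hp0]
    field_simp
    ring
  have h3 := RankinComposed.sum_excess_le hZ2 hη0 hη12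
  have h4 := Literature.NumberTheory.LFunctions.MertensBound.sum_inv_prime_le Z hZ2
  -- `log log Z ≤ ℓ₂`
  have hlogZ0 : 0 < Real.log Z := Real.log_pos (by exact_mod_cast (show 1 < Z by omega))
  have hloglogZ : Real.log (Real.log Z) ≤ ℓ₂ := by
    rw [hℓ₂]
    refine Real.log_le_log hlogZ0 (hZ.trans ?_)
    rw [div_le_iff₀ (by positivity)]
    nlinarith
  -- `Z^η ≤ exp(7 ℓ₃/8) ≤ ℓ₂/96`
  have hZη : (Z : ℝ) ^ η ≤ ℓ₂ / 96 := by
    rw [Real.rpow_def_of_pos hZ0]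
    have hle : Real.log Z * η ≤ 7 / 8 * ℓ₃ := by
      calc Real.log Z * η ≤ ℓ * ℓ₃ / (4 * ℓ₂) * η := mul_le_mul_of_nonneg_right hZ hη0.le
        _ = 7 / 8 * ℓ₃ := by rw [hη]; field_simp; ring
    calc Real.exp (Real.log Z * η) ≤ Real.exp (7 / 8 * ℓ₃) := Real.exp_le_exp.2 hle
      _ = Real.exp ℓ₃ * Real.exp (-(ℓ₃ / 8)) := by rw [← Real.exp_add]; ring_nf
      _ ≤ ℓ₂ * (1 / 96) := by
          rw [hexpℓ₃]
          refine mul_le_mul_of_nonneg_left ?_ hℓ₂0.le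
          have h96 : Real.exp (-(ℓ₃ / 8)) ≤ Real.exp (-Real.log 96) :=
            Real.exp_le_exp.2 (by linarith)
          rwa [Real.exp_neg (Real.log 96), Real.exp_log (by norm_num), inv_eq_one_div] at h96
      _ = ℓ₂ / 96 := by ring
  -- the exponent
  have hexp : ∑ p ∈ (Z + 1).primesBelow, (p : ℝ) ^ (-σ) + RankinComposed.C₀ ≤
      3 / 2 * ℓ₂ - Real.log c := by
    rw [hsum]; linarith
  -- `Y^σ ≤ Y exp(−(7/2) ℓ₂)`
  have hYσ : (Y : ℝ) ^ σ ≤ Y * Real.exp (-(7 / 2 * ℓ₂)) := by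
    rw [hσdef, Real.rpow_sub hY0, Real.rpow_one, div_eq_mul_inv]
    refine mul_le_mul_of_nonneg_left ?_ hY0.le
    have hxη : (x : ℝ) ^ η = Real.exp (7 / 2 * ℓ₂) := by
      rw [Real.rpow_def_of_pos hx0, ← hℓ, hη]
      congr 1; field_simp
    have hle : (x : ℝ) ^ η ≤ (Y : ℝ) ^ η :=
      Real.rpow_le_rpow hx0.le (by exact_mod_cast hxY) hη0.le
    rw [Real.exp_neg]
    rw [hxη] at hle
    exact inv_anti₀ (Real.exp_pos _) hle
  -- assemble
  have hprod0 : 0 ≤ ∏ p ∈ (Z + 1).primesBelow, (1 - (p : ℝ) ^ (-σ))⁻¹ := by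
    refine Finset.prod_nonneg fun p hp => inv_nonneg.2 ?_
    have hp2 : (2 : ℝ) ≤ p := by exact_mod_cast (hprimes p hp).two_le
    have : (p : ℝ) ^ (-σ) ≤ 1 := Real.rpow_le_one_of_one_le_of_nonpos (by linarith) (by linarith)
    linarith
  calc ((Nat.smoothNumbersUpTo Y (Z + 1)).card : ℝ)
      ≤ (Y : ℝ) ^ σ * ∏ p ∈ (Z + 1).primesBelow, (1 - (p : ℝ) ^ (-σ))⁻¹ := h1
    _ ≤ (Y * Real.exp (-(7 / 2 * ℓ₂))) * Real.exp (3 / 2 * ℓ₂ - Real.log c) :=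
        mul_le_mul hYσ (h2.trans (Real.exp_le_exp.2 hexp)) hprod0 (by positivity)
    _ = Y * (Real.exp (-(2 * ℓ₂)) / c) := by
        rw [mul_assoc, ← Real.exp_add, show -(7 / 2 * ℓ₂) + (3 / 2 * ℓ₂ - Real.log c) =
          -(2 * ℓ₂) + -Real.log c by ring, Real.exp_add, Real.exp_neg (Real.log c),
          Real.exp_log hc, div_eq_mul_inv]
    _ ≤ c * ((x : ℝ) * ℓ * ℓ₃ / ℓ₂) * (Real.exp (-(2 * ℓ₂)) / c) :=
        mul_le_mul_of_nonneg_right hY (by positivity)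
    _ = (x : ℝ) / ℓ * (ℓ₃ / ℓ₂) := by
        have : Real.exp (-(2 * ℓ₂)) = (ℓ ^ 2)⁻¹ := by
          rw [Real.exp_neg, ← hexpℓ₂, ← Real.exp_nat_mul]; norm_num
        rw [this]; field_simp
    _ ≤ (x : ℝ) / ℓ := by
        have : ℓ₃ / ℓ₂ ≤ 1 := (div_le_one hℓ₂0).2 hℓ₃le
        exact mul_le_of_le_one_right (by positivity) this

/-! ### Step 5: primes in `(x, Cx]` (prime number theorem) -/

/-- PNT `π(x) ~ x/log x` with relative error `κ`. [cite: Poussin1896] -/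
private theorem fgkmt_eventually_abs_primeCounting_sub_le {κ : ℝ} (hκ : 0 < κ) :
    ∀ᶠ x : ℝ in atTop,
      |(Nat.primeCounting ⌊x⌋₊ : ℝ) - x / Real.log x| ≤ κ * (x / Real.log x) := by
  have h0 : Asymptotics.IsEquivalent atTop (fun x : ℝ ↦ (Nat.primeCounting ⌊x⌋₊ : ℝ))
      (fun x ↦ x / Real.log x) :=
    Literature.NumberTheory.LFunctions.primeCounting_isEquivalent_holds
  filter_upwards [h0.isLittleO.bound hκ, eventually_ge_atTop (1 : ℝ)] with x hx hx1
  have hx0 : 0 ≤ x := by linarith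
  have hl0 : 0 ≤ Real.log x := Real.log_nonneg hx1
  have hnn : 0 ≤ x / Real.log x := div_nonneg hx0 hl0
  simpa [Real.norm_eq_abs, abs_div, abs_of_nonneg hnn, abs_of_nonneg hx0, abs_of_nonneg hl0]
    using hx

/-- «Let `C` be a sufficiently large constant such that `#𝒯` is less than the number of primes in
`(x, Cx]`»: for every `K` there is `C ∈ ℕ` with `#{p prime : x < p ≤ Cx} ≥ K x/log x + 1` for all
large `x` (prime number theorem). [cite: FordGreenKonyaginMaynardTao2018, §3 (proof of (1.2))] -/
theorem exists_eventually_card_primes_Ioc_ge (K : ℝ) : ∃ C : ℕ, 1 ≤ C ∧ ∀ᶠ x : ℕ in atTop,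
    K * ((x : ℝ) / Real.log x) + 1 ≤ (((Finset.Ioc x (C * x)).filter Nat.Prime).card : ℝ) := by
  classical
  set K0 : ℝ := max K 0 with hK0def
  have hK00 : 0 ≤ K0 := le_max_right _ _
  refine ⟨⌈4 * K0⌉₊ + 14, by omega, ?_⟩
  set C : ℕ := ⌈4 * K0⌉₊ + 14 with hCdef
  have hC14 : 14 ≤ C := by omega
  have hCK : 4 * K0 + 14 ≤ C := by
    have : (⌈4 * K0⌉₊ : ℝ) ≥ 4 * K0 := Nat.le_ceil _
    have hC' : (C : ℝ) = ⌈4 * K0⌉₊ + 14 := by rw [hCdef]; push_cast; ring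
    rw [hC']; linarith
  have hCpos : 0 < C := by omega
  have hmul : Tendsto (fun n : ℕ => C * n) atTop atTop :=
    Filter.tendsto_atTop_mono (fun n => Nat.le_mul_of_pos_left n hCpos) tendsto_id
  have hpnt := fgkmt_eventually_abs_primeCounting_sub_le (show (0 : ℝ) < 1 / 2 by norm_num)
  have hA := tendsto_natCast_atTop_atTop.eventually hpnt
  have hB := (tendsto_natCast_atTop_atTop.comp hmul).eventually hpnt
  filter_upwards [hA, hB, eventually_ge_atTop (max C 16)] with x hx hCx hxge
  simp only [Function.comp, Nat.floor_natCast] at hx hCx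
  have hxC : C ≤ x := le_trans (le_max_left _ _) hxge
  have hx16 : 16 ≤ x := le_trans (le_max_right _ _) hxge
  have hx0 : (0 : ℝ) < x := by exact_mod_cast (show 0 < x by omega)
  have hC0 : (0 : ℝ) < C := by exact_mod_cast hCpos
  have hxC' : (C : ℝ) ≤ x := by exact_mod_cast hxC
  have hℓ1 : 1 < Real.log x := by
    rw [← Real.exp_lt_exp, Real.exp_log hx0]
    have : (16 : ℝ) ≤ x := by exact_mod_cast hx16
    have := Real.exp_one_lt_d9; linarith
  have hℓ0 : 0 < Real.log x := by linarith
  have hlogC : Real.log ((C * x : ℕ) : ℝ) = Real.log C + Real.log x := by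
    push_cast; rw [Real.log_mul hC0.ne' hx0.ne']
  have hlogCle : Real.log ((C * x : ℕ) : ℝ) ≤ 2 * Real.log x := by
    rw [hlogC]; linarith [Real.log_le_log hC0 hxC']
  have hlogC0 : 0 < Real.log ((C * x : ℕ) : ℝ) := by
    rw [hlogC]; linarith [Real.log_nonneg (show (1 : ℝ) ≤ C by exact_mod_cast hCpos)]
  -- the count is `π(Cx) − π(x)`
  have hcard : (((Finset.Ioc x (C * x)).filter Nat.Prime).card : ℝ) =
      (Nat.primeCounting (C * x) : ℝ) - Nat.primeCounting x := by
    have hsub : Nat.primesLE x ⊆ Nat.primesLE (C * x) := by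
      intro p hp
      rw [Nat.mem_primesLE] at hp ⊢
      exact ⟨hp.1.trans (Nat.le_mul_of_pos_left x hCpos), hp.2⟩
    have hset : (Finset.Ioc x (C * x)).filter Nat.Prime = Nat.primesLE (C * x) \ Nat.primesLE x := by
      ext p
      simp only [Finset.mem_filter, Finset.mem_Ioc, Finset.mem_sdiff, Nat.mem_primesLE]
      constructor
      · rintro ⟨⟨h1, h2⟩, hp⟩; exact ⟨⟨h2, hp⟩, fun h => absurd h.1 (not_le.2 h1)⟩
      · rintro ⟨⟨h2, hp⟩, h⟩; exact ⟨⟨not_le.1 fun h1 => h ⟨h1, hp⟩, h2⟩, hp⟩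
    rw [hset, Finset.card_sdiff_of_subset hsub, Nat.cast_sub (Finset.card_le_card hsub),
      Nat.primesLE_card_eq_primeCounting, Nat.primesLE_card_eq_primeCounting]
  rw [hcard]
  -- lower bound for `π(Cx)`, upper bound for `π(x)`
  have hup : (Nat.primeCounting x : ℝ) ≤ 3 / 2 * (x / Real.log x) := by
    have := (abs_le.1 hx).2; linarith
  have hlow : (C : ℝ) * x / (4 * Real.log x) ≤ Nat.primeCounting (C * x) := by
    have h1 := (abs_le.1 hCx).1
    have h2 : (1 / 2 : ℝ) * (((C * x : ℕ) : ℝ) / Real.log ((C * x : ℕ) : ℝ)) ≤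
        Nat.primeCounting (C * x) := by linarith
    refine le_trans ?_ h2
    have h3 : ((C * x : ℕ) : ℝ) / (2 * Real.log x) ≤ ((C * x : ℕ) : ℝ) / Real.log ((C * x : ℕ) : ℝ) :=
      div_le_div_of_nonneg_left (by positivity) hlogC0 hlogCle
    have h4 : (C : ℝ) * x / (4 * Real.log x) = 1 / 2 * (((C * x : ℕ) : ℝ) / (2 * Real.log x)) := by
      push_cast; field_simp; ring
    rw [h4]; linarith
  have hxℓ : 1 ≤ (x : ℝ) / Real.log x := by
    rw [le_div_iff₀ hℓ0, one_mul]
    have : (16 : ℝ) ≤ x := by exact_mod_cast hx16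
    linarith [Real.log_le_sub_one_of_pos hx0]
  have hKle : K * ((x : ℝ) / Real.log x) ≤ K0 * ((x : ℝ) / Real.log x) :=
    mul_le_mul_of_nonneg_right (le_max_left _ _) (by positivity)
  have hmain : K0 * ((x : ℝ) / Real.log x) + 1 ≤
      (C : ℝ) * x / (4 * Real.log x) - 3 / 2 * (x / Real.log x) := by
    have : (C : ℝ) * x / (4 * Real.log x) = (C / 4) * (x / Real.log x) := by
      field_simp
    rw [this]
    have hCX := mul_le_mul_of_nonneg_right hCK (show (0 : ℝ) ≤ x / Real.log x by positivity)
    linarith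
  linarith

/-! ### Step 6: growth conditions and the comparison of rates -/

/-- The growth conditions used above hold for all large `x ∈ ℕ` (`log`, `log₂`, `log₃ → ∞`,
`log₂ x = o(log x)`, `log²⁰ x = o(x)`). [cite: FordGreenKonyaginMaynardTao2018, §3 («`x` sufficiently large»)] -/
private theorem fgkmt_eventually_growth {c : ℝ} (hc : 0 < c) : ∀ᶠ x : ℕ in atTop,
    16 ≤ x ∧ 2 * (Real.log x) ^ 20 ≤ (x : ℝ) ∧ 2 * c + 1 ≤ Real.log x ∧
      8 * Real.log 96 ≤ Real.log (Real.log (Real.log x)) ∧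
      Real.log c + 7 + RankinComposed.C₀ ≤ Real.log (Real.log x) / 4 ∧
      35 * Real.log (Real.log x) ≤ 4 * Real.log x ∧
      4 * Real.log (Real.log x) ≤ c * Real.log x := by
  have hℓ : Tendsto (fun x : ℕ => Real.log x) atTop atTop :=
    Real.tendsto_log_atTop.comp tendsto_natCast_atTop_atTop
  have hℓ₂ : Tendsto (fun x : ℕ => Real.log (Real.log x)) atTop atTop :=
    Real.tendsto_log_atTop.comp hℓ
  have hℓ₃ : Tendsto (fun x : ℕ => Real.log (Real.log (Real.log x))) atTop atTop :=
    Real.tendsto_log_atTop.comp hℓ₂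
  -- `log²⁰ x ≤ x/2`
  have h20 : ∀ᶠ x : ℕ in atTop, 2 * (Real.log x) ^ 20 ≤ (x : ℝ) := by
    have h := (Real.isLittleO_pow_log_id_atTop (n := 20)).bound (show (0 : ℝ) < 1 / 2 by norm_num)
    filter_upwards [tendsto_natCast_atTop_atTop.eventually h] with x hx
    have h1 : ‖Real.log (x : ℝ) ^ 20‖ ≤ 1 / 2 * ‖(x : ℝ)‖ := by simpa only [id_eq] using hx
    rw [Real.norm_eq_abs, Real.norm_eq_abs, abs_of_nonneg (Nat.cast_nonneg (α := ℝ) x)] at h1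
    linarith [le_abs_self (Real.log (x : ℝ) ^ 20)]
  -- `log₂ x ≤ ε log x`
  have hlo : ∀ ε : ℝ, 0 < ε → ∀ᶠ x : ℕ in atTop, Real.log (Real.log x) ≤ ε * Real.log x := by
    intro ε hε
    have h := Real.isLittleO_log_id_atTop.bound hε
    filter_upwards [hℓ.eventually h, hℓ.eventually_ge_atTop 0] with x hx hx0
    have h1 : ‖Real.log (Real.log (x : ℝ))‖ ≤ ε * ‖Real.log (x : ℝ)‖ := by
      simpa only [id_eq, Function.comp] using hx
    rw [Real.norm_eq_abs, Real.norm_eq_abs, abs_of_nonneg hx0] at h1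
    linarith [le_abs_self (Real.log (Real.log (x : ℝ)))]
  filter_upwards [eventually_ge_atTop 16, h20, hℓ.eventually_ge_atTop (2 * c + 1),
    hℓ₃.eventually_ge_atTop (8 * Real.log 96),
    hℓ₂.eventually_ge_atTop (4 * (Real.log c + 7 + RankinComposed.C₀)),
    hlo (4 / 35) (by norm_num), hlo (c / 4) (by positivity)] with x h1 h2 h3 h4 h5 h6 h7
  exact ⟨h1, h2, h3, h4, by linarith, by linarith, by linarith⟩

/-- Comparison of the rate `x log x log₃ x/log₂ x` at comparable arguments: for
`e^{e^e} ≤ u ≤ v ≤ min(A u, u²)`, `v log v log₃ v/log₂ v ≤ 2A · u log u log₃ u/log₂ u`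
(`log v ≤ 2 log u`, and `t ↦ log t/t` is decreasing on `[e, ∞)`, applied to `t = log₂`).
[cite: FordGreenKonyaginMaynardTao2018, (1.2) (the rate function)] -/
theorem fgkmtRate_le_of_le {u v A : ℝ} (hu : Real.exp (Real.exp (Real.exp 1)) ≤ u) (huv : u ≤ v)
    (hvA : v ≤ A * u) (hv2 : v ≤ u ^ 2) :
    v * Real.log v * Real.log (Real.log (Real.log v)) / Real.log (Real.log v) ≤
      2 * A * (u * Real.log u * Real.log (Real.log (Real.log u)) / Real.log (Real.log u)) := by
  have he : 0 < Real.exp (Real.exp (Real.exp 1)) := Real.exp_pos _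
  have hu0 : 0 < u := lt_of_lt_of_le he hu
  have hv0 : 0 < v := lt_of_lt_of_le hu0 huv
  have hlu : Real.exp (Real.exp 1) ≤ Real.log u := by
    rw [Real.le_log_iff_exp_le hu0]; exact hu
  have hlu0 : 0 < Real.log u := lt_of_lt_of_le (Real.exp_pos _) hlu
  have hllu : Real.exp 1 ≤ Real.log (Real.log u) := by
    rw [Real.le_log_iff_exp_le hlu0]; exact hlu
  have hllu0 : 0 < Real.log (Real.log u) := lt_of_lt_of_le (Real.exp_pos _) hllu
  have hlv : Real.log u ≤ Real.log v := Real.log_le_log hu0 huv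
  have hlv0 : 0 < Real.log v := lt_of_lt_of_le hlu0 hlv
  have hllv : Real.log (Real.log u) ≤ Real.log (Real.log v) := Real.log_le_log hlu0 hlv
  have hllv0 : 0 < Real.log (Real.log v) := lt_of_lt_of_le hllu0 hllv
  have hlllu0 : 0 ≤ Real.log (Real.log (Real.log u)) := by
    refine Real.log_nonneg ?_; have := Real.exp_one_gt_d9; linarith
  -- `log₃ v/log₂ v ≤ log₃ u/log₂ u`
  have hanti : Real.log (Real.log (Real.log v)) / Real.log (Real.log v) ≤
      Real.log (Real.log (Real.log u)) / Real.log (Real.log u) :=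
    Real.log_div_self_antitoneOn hllu (le_trans hllu hllv) hllv
  -- `log v ≤ 2 log u`
  have hlv2 : Real.log v ≤ 2 * Real.log u := by
    calc Real.log v ≤ Real.log (u ^ 2) := Real.log_le_log hv0 hv2
      _ = 2 * Real.log u := by rw [Real.log_pow]; norm_num
  have hA : 0 ≤ A * u := le_trans hv0.le hvA
  calc v * Real.log v * Real.log (Real.log (Real.log v)) / Real.log (Real.log v)
      = v * Real.log v * (Real.log (Real.log (Real.log v)) / Real.log (Real.log v)) := by ring
    _ ≤ (A * u) * (2 * Real.log u) *
        (Real.log (Real.log (Real.log u)) / Real.log (Real.log u)) := by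
        have h3 : 0 ≤ Real.log (Real.log (Real.log v)) / Real.log (Real.log v) :=
          div_nonneg (le_trans hlllu0 (Real.log_le_log hllu0 hllv)) hllv0.le
        exact mul_le_mul (mul_le_mul hvA hlv2 hlv0.le hA) hanti h3 (by positivity)
    _ = 2 * A * (u * Real.log u * Real.log (Real.log (Real.log u)) / Real.log (Real.log u)) := by
        ring

/-! ### Step 7: Theorem 2 ⇒ (1.2) ⇒ Theorem 1 -/

/-- `Real.log^[2] = log ∘ log`, `Real.log^[3] = log ∘ log ∘ log`. [folklore] -/
private theorem fgkmt_iterate_log_two_three (w : ℝ) :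
    Real.log^[2] w = Real.log (Real.log w) ∧ Real.log^[3] w = Real.log (Real.log (Real.log w)) := by
  constructor <;> simp [Function.iterate_succ_apply']

set_option maxHeartbeats 800000 in
/-- **The covering at `Cx`.** From Theorem 2: there are `c > 0` and `C ∈ ℕ` such that for all large
`x ∈ ℕ` one has `⌊y⌋ − x ≥ y/2` and `Y(Cx) ≥ ⌊y⌋ − x`, `y = c x log x log₃ x/log₂ x`
(«`y − x + 1 ≥ Y(Cx)`» [sic] in the paper). [cite: FordGreenKonyaginMaynardTao2018, §3 (proof of (1.2))] -/
theorem eventually_cover_of_theorem2 (h : FordGreenKonyaginMaynardTao2018_theorem2) :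
    ∃ c : ℝ, 0 < c ∧ ∃ C : ℕ, 1 ≤ C ∧ ∀ᶠ x : ℕ in atTop,
      ySieve c x / 2 ≤ ((⌊ySieve c x⌋₊ - x : ℕ) : ℝ) ∧
        ResidueClassesCover (C * x) (⌊ySieve c x⌋₊ - x) := by
  classical
  obtain ⟨c, hc, K, hK⟩ := h
  obtain ⟨C, hC1, hCev⟩ := exists_eventually_card_primes_Ioc_ge (K + 1)
  refine ⟨c, hc, C, hC1, ?_⟩
  filter_upwards [hK, hCev, fgkmt_eventually_growth hc] with x hx hCx hg
  obtain ⟨hx16, h20, h2c, hG1, hG2, h35, h4c⟩ := hg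
  obtain ⟨a, b, hab⟩ := hx
  obtain ⟨i2, i3⟩ := fgkmt_iterate_log_two_three (x : ℝ)
  -- notation
  set ℓ : ℝ := Real.log x with hℓ
  set ℓ₂ : ℝ := Real.log ℓ with hℓ₂
  set ℓ₃ : ℝ := Real.log ℓ₂ with hℓ₃
  have hx0 : (0 : ℝ) < x := by exact_mod_cast (show 0 < x by omega)
  have hx16' : (16 : ℝ) ≤ x := by exact_mod_cast hx16
  have hℓ1 : 1 < ℓ := by
    rw [hℓ, ← Real.exp_lt_exp, Real.exp_log hx0]
    have := Real.exp_one_lt_d9; linarith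
  have hℓ0 : 0 < ℓ := by linarith
  have hℓ₂0 : 0 < ℓ₂ := Real.log_pos hℓ1
  have hlog96 : 0 < Real.log 96 := Real.log_pos (by norm_num)
  have hℓ₃1 : 1 ≤ ℓ₃ := by
    have : Real.log 2 ≤ Real.log 96 := Real.log_le_log (by norm_num) (by norm_num)
    linarith [Real.log_two_gt_d9]
  have hℓ₃le : ℓ₃ ≤ ℓ₂ := by linarith [Real.log_le_sub_one_of_pos hℓ₂0]
  have hℓ₂le : ℓ₂ ≤ ℓ := by linarith [Real.log_le_sub_one_of_pos hℓ0]
  -- the values of `y` and `z`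
  have hy : ySieve c x = c * ((x : ℝ) * ℓ * ℓ₃ / ℓ₂) := by
    rw [ySieve, i2, i3]
  have hzexp : zSieve x = Real.exp (ℓ * ℓ₃ / (4 * ℓ₂)) := by
    rw [zSieve, i2, i3, Real.rpow_def_of_pos hx0]
    congr 1; rw [← hℓ]; field_simp
  have hz0 : 0 < zSieve x := by rw [hzexp]; exact Real.exp_pos _
  -- `y ≥ 4x`, `y ≤ c x ℓ`
  have hrate : 4 * (x : ℝ) ≤ ySieve c x := by
    rw [hy]
    have e1 : 4 * (x : ℝ) * ℓ₂ ≤ (x : ℝ) * (c * ℓ) := by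
      have := mul_le_mul_of_nonneg_left h4c hx0.le
      linarith
    have e2 : (x : ℝ) * (c * ℓ) ≤ c * ((x : ℝ) * ℓ * ℓ₃) := by
      have h0 : 0 ≤ c * ((x : ℝ) * ℓ) := by positivity
      have := mul_le_mul_of_nonneg_left hℓ₃1 h0
      nlinarith
    rw [mul_div_assoc', le_div_iff₀ hℓ₂0]; linarith
  have hy0 : 0 ≤ ySieve c x := by linarith
  have hyle : ySieve c x ≤ c * ((x : ℝ) * ℓ) := by
    rw [hy]
    refine mul_le_mul_of_nonneg_left ?_ hc.le
    rw [div_le_iff₀ hℓ₂0]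
    exact mul_le_mul_of_nonneg_left hℓ₃le (by positivity)
  -- hypotheses of Steps 1–2
  have hA1 : 2 * ySieve c x < (x : ℝ) * ℓ ^ 20 := by
    have h2c' : 2 * c * ℓ < ℓ ^ 20 := by
      have h' : ℓ ^ 20 = ℓ ^ 19 * ℓ := pow_succ ℓ 19
      rw [h']
      have : 2 * c < ℓ ^ 19 := lt_of_lt_of_le (by linarith) (le_self_pow₀ hℓ1.le (by norm_num))
      exact mul_lt_mul_of_pos_right this hℓ0
    have h3 : c * ((x : ℝ) * ℓ) * 2 < (x : ℝ) * ℓ ^ 20 := by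
      have := mul_lt_mul_of_pos_left h2c' hx0
      linarith
    linarith
  have hA3 : 2 * zSieve x ≤ (x : ℝ) := by
    rw [hzexp]
    have hxexp : (x : ℝ) = Real.exp ℓ := by rw [hℓ, Real.exp_log hx0]
    have h2 : (2 : ℝ) = Real.exp (Real.log 2) := by rw [Real.exp_log (by norm_num)]
    rw [hxexp, h2, ← Real.exp_add, Real.exp_le_exp]
    have hq : ℓ * ℓ₃ / (4 * ℓ₂) ≤ ℓ / 4 := by
      rw [div_le_iff₀ (by positivity)]
      have := mul_le_mul_of_nonneg_left hℓ₃le hℓ0.le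
      linarith
    linarith [Real.log_two_lt_d9]
  -- Step 2: count of the uncovered set
  set Y : ℕ := ⌊ySieve c x⌋₊ with hYdef
  set Z : ℕ := ⌊zSieve x⌋₊ with hZdef
  have hcount := card_uncoveredShifts_le (a := a) (b := b) hA1 h20 hA3
  -- Step 4: the smooth part
  have hxY : x ≤ Y := by
    rw [hYdef, Nat.le_floor_iff hy0]; linarith
  have hYle : (Y : ℝ) ≤ c * ((x : ℝ) * ℓ * ℓ₃ / ℓ₂) := by
    rw [← hy]; exact Nat.floor_le hy0
  have hZ2 : 2 ≤ Z := by
    rw [hZdef, Nat.le_floor_iff hz0.le, hzexp]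
    have h2 : ((2 : ℕ) : ℝ) = Real.exp (Real.log 2) := by push_cast; rw [Real.exp_log (by norm_num)]
    rw [h2, Real.exp_le_exp]
    have : (35 / 16 : ℝ) * ℓ₃ ≤ ℓ * ℓ₃ / (4 * ℓ₂) := by
      rw [le_div_iff₀ (by positivity)]
      have := mul_le_mul_of_nonneg_right h35 (le_trans zero_le_one hℓ₃1)
      linarith
    linarith [Real.log_two_lt_d9]
  have hZlog : Real.log Z ≤ ℓ * ℓ₃ / (4 * ℓ₂) := by
    have hZz : (Z : ℝ) ≤ zSieve x := Nat.floor_le hz0.le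
    have hZ0 : (0 : ℝ) < Z := by exact_mod_cast (show 0 < Z by omega)
    calc Real.log Z ≤ Real.log (zSieve x) := Real.log_le_log hZ0 hZz
      _ = ℓ * ℓ₃ / (4 * ℓ₂) := by rw [hzexp, Real.log_exp]
  have hsmooth := card_smooth_le_of_params (Y := Y) (Z := Z) hc hx16 hℓ hℓ₂ hℓ₃ rfl
    (by rw [div_le_iff₀ hℓ0]; linarith) hZ2 hZlog hxY hYle hG1 hG2
  -- Step 3/5: the cover at `Cx`
  have hle : ((uncoveredShifts x (Y - x) a b).card : ℝ) ≤
      (((Finset.Ioc x (C * x)).filter Nat.Prime).card : ℝ) := by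
    have h1 : ((uncoveredShifts x (Y - x) a b).card : ℝ) ≤
        ((Nat.smoothNumbersUpTo Y (Z + 1)).card : ℝ) + ((siftedPrimes c x a b).card : ℝ) := by
      exact_mod_cast hcount
    have h2 : (K + 1) * ((x : ℝ) / ℓ) = (x : ℝ) / ℓ + K * ((x : ℝ) / ℓ) := by ring
    linarith
  refine ⟨?_, residueClassesCover_of_card_le hC1 (by exact_mod_cast hle)⟩
  -- `⌊y⌋ − x ≥ y − 1 − x ≥ y/2`
  have hYr : ySieve c x - 1 ≤ (Y : ℝ) := by
    have := Nat.lt_floor_add_one (ySieve c x); rw [← hYdef] at this; linarith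
  rw [Nat.cast_sub hxY]
  linarith

end FGKMT2018

open FGKMT2018 in
/-- **Ford–Green–Konyagin–Maynard–Tao 2018, §3: Theorem 2 ⇒ (1.2)** («Here, we show how this theorem
implies (1.2), and hence Theorem 1»): the sieving-primes theorem implies the covering bound
`Y(x) ≫ x log x log₃ x/log₂ x`. PROVED (the constant obtained is `c/(8C)`).
[cite: FordGreenKonyaginMaynardTao2018, §3 (Theorem 2 ⇒ (1.2))] -/
theorem fgkmt2018_coveringBound_of_theorem2 (h : FordGreenKonyaginMaynardTao2018_theorem2) :
    FordGreenKonyaginMaynardTao2018_coveringBound := by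
  classical
  obtain ⟨c, hc, C, hC1, hev⟩ := eventually_cover_of_theorem2 h
  have hC0 : 0 < C := hC1
  have hCr : (1 : ℝ) ≤ C := by exact_mod_cast hC1
  -- `x' ↦ x'/C → ∞`
  have hdiv : Tendsto (fun x' : ℕ => x' / C) atTop atTop := by
    refine Filter.tendsto_atTop_atTop.2 fun b => ⟨b * C, fun a ha => ?_⟩
    exact (Nat.le_div_iff_mul_le hC0).2 ha
  refine ⟨c / (8 * C), by positivity, ?_⟩
  have hbig : ∀ᶠ x' : ℕ in atTop, (4 * C ^ 2 : ℕ) ≤ x' ∧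
      Real.exp (Real.exp (Real.exp 1)) ≤ (((x' / C : ℕ)) : ℝ) := by
    filter_upwards [eventually_ge_atTop (4 * C ^ 2),
      (tendsto_natCast_atTop_atTop.comp hdiv).eventually_ge_atTop
        (Real.exp (Real.exp (Real.exp 1)))] with x' h1 h2
    exact ⟨h1, h2⟩
  filter_upwards [hdiv.eventually hev, hbig] with x' hx hb
  obtain ⟨hhalf, hcov⟩ := hx
  obtain ⟨h4C, hexp⟩ := hb
  set x : ℕ := x' / C with hxdef
  obtain ⟨i2, i3⟩ := FGKMT2018.fgkmt_iterate_log_two_three (x' : ℝ)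
  obtain ⟨j2, j3⟩ := FGKMT2018.fgkmt_iterate_log_two_three (x : ℝ)
  refine ⟨⌊ySieve c x⌋₊ - x, ?_, hcov.mono (Nat.div_mul_le_self x' C |>.trans_eq' (by
    rw [hxdef, mul_comm])) le_rfl⟩
  -- compare the rates at `x = ⌊x'/C⌋` and `x'`
  have hCx : C * x ≤ x' := by rw [hxdef, mul_comm]; exact Nat.div_mul_le_self x' C
  have hx'C : x' < C * x + C := by
    rw [hxdef]; exact Nat.lt_div_mul_add (by omega) |>.trans_eq (by ring)
  have hxx' : (x : ℝ) ≤ x' := by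
    have : x ≤ x' := le_trans (Nat.le_mul_of_pos_left x hC0) hCx
    exact_mod_cast this
  have hC2 : (4 * C ^ 2 : ℝ) ≤ x' := by exact_mod_cast h4C
  have hx'r : (x' : ℝ) < C * x + C := by exact_mod_cast hx'C
  have hxlow : (x' : ℝ) ≤ 2 * C * x := by nlinarith
  have hxsq : (x' : ℝ) ≤ (x : ℝ) ^ 2 := by nlinarith
  have hrate := fgkmtRate_le_of_le (A := 2 * C) hexp hxx' hxlow hxsq
  rw [i2, i3]
  have hy : ySieve c x = c * ((x : ℝ) * Real.log x * Real.log (Real.log (Real.log x)) /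
      Real.log (Real.log x)) := by rw [ySieve, j2, j3]
  rw [hy] at hhalf
  have hC0r : (0 : ℝ) < C := by exact_mod_cast hC0
  calc c / (8 * C) * ((x' : ℝ) * Real.log x' * Real.log (Real.log (Real.log x')) /
        Real.log (Real.log x'))
      ≤ c / (8 * C) * (2 * (2 * C) * ((x : ℝ) * Real.log x * Real.log (Real.log (Real.log x)) /
          Real.log (Real.log x))) := mul_le_mul_of_nonneg_left hrate (by positivity)
    _ = c * ((x : ℝ) * Real.log x * Real.log (Real.log (Real.log x)) / Real.log (Real.log x)) / 2 := by
        field_simp; ring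
    _ ≤ _ := hhalf

/-- **Ford–Green–Konyagin–Maynard–Tao 2018: Theorem 2 ⇒ Theorem 1** (`G(X) ≫ log X log₂ X log₄ X/log₃ X`),
composing with the PROVED transfer `(1.2) ⇒ Theorem 1` (`fgkmt2018_theorem1_of_coveringBound`, Lemma 1.1).
[cite: FordGreenKonyaginMaynardTao2018, §3 («and hence Theorem 1»)] -/
theorem fgkmt2018_theorem1_of_theorem2 (h : FordGreenKonyaginMaynardTao2018_theorem2) :
    FordGreenKonyaginMaynardTao2018_theorem1 :=
  fgkmt2018_theorem1_of_coveringBound (fgkmt2018_coveringBound_of_theorem2 h)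

/-- Hence Theorem 2 also yields every Rankin constant (`G(X) ≥ (c − ε)·Rankin's rate` for every `c`).
[cite: FordGreenKonyaginMaynardTao2018, (1.1) and Theorem 1] -/
theorem rankinConstant_of_fgkmt2018_theorem2 (h : FordGreenKonyaginMaynardTao2018_theorem2) (c : ℝ) :
    RankinConstant c :=
  rankinConstant_of_fgkmt (fgkmt2018_theorem1_of_theorem2 h) c

end Literature.NumberTheory.Sieve
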